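import Literature.NumberTheory.LFunctions.WeilTwoPrimeMinorant
import Literature.Analysis.ValidatedNumerics.MultiPrecisionInterval
import HarnessLib

/-!
# Two-prime minorant cells: a multi-precision checker for the ripple constants

Topic: `Literature/NumberTheory/LFunctions`. The integer cell checker `TPDCell.checkZ` (`WeilTwoPrimeCells.lean`) compares
the claimed ripple constants `alo ≤ −√2 log 2 cos(u log 2)`, `blo ≤ √2 log 2 sin(u log 2)`, `a3lo ≤ −(2 log 3/√3) cos(u log 3)`,
`b3lo ≤ (2 log 3/√3) sin(u log 3)` with the fixed-scale (`2^48`) engine values `alphaLoQ/betaLoQ/alpha3LoQ/beta3LoQ`, whose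
`cos`/`sin` enclosures are only `10⁻¹¹ … 5·10⁻⁹` accurate at the arguments met on `[0, 120]`; the minorant cells inherit that
slack, which caps the odd-sector margin certificates of the two-prime form near the window `log 2`.  This file gives a second
checker, **`TPDCell.checkZMP`**, identical to `checkZ` except that the four ripple constants are compared with enclosures
computed by the MULTI-PRECISION engine (`MI.logNat`, `MI.pi`, `MC.expI` of `MultiPrecisionInterval.lean`, any scale `2^sb`):
`trigEnclMP` / `alphaLoMP` / `betaLoMP` with their soundness, the real-hypothesis forms of the ripple soundness lemmas
(`FPDCell.polyR_cosPart_le_real`, `TPDCell.polyR_cosPart3_le_real`), **`TPDCell.valid_of_checkZMP`** (a checked cell is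
`TPDCell.Valid`), the chain checker **`checkCells₂₃MP`** and **`cellsOK_of_checkCells₂₃MP`** (`→ CellsOK₂₃ wL T cells`, the
hypothesis of `WeilCert23.margin_step3_of_cellsOK`).  The cell polynomial, its moments and `bndQ` are unchanged, so the moment
and certificate layers apply verbatim.  Everything here is proved; no named facts.

## References

* H. Yoshida, *On Hermitian forms attached to zeta functions*, Adv. Stud. Pure Math. 21 (1992), §6. [Yoshida1992]
* R. P. Brent, P. Zimmermann, *Modern Computer Arithmetic* (2010), §4.3 (argument reduction for `exp`). [BrentZimmermann2010]
-/

noncomputable section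

open Real Set
open scoped BigOperators

namespace Literature.NumberTheory.LFunctions

open Literature.Analysis.ValidatedNumerics.Numerics
open Literature.Analysis.ValidatedNumerics.NumericsMP
open Literature.Analysis.SpecialFunctions

/-! ## Multi-precision enclosures of `cos(u log n)`, `sin(u log n)` -/

/-- Parameters of the multi-precision evaluation: scale `2^sb`, `K` series terms, `k` argument halvings. [folklore] -/
structure MPParams where
  /-- scale bits (`S = 2^sb`) -/
  sb : ℕ
  /-- number of series terms (`MI.logNat`, `MI.pi`, `MC.expI`) -/
  K : ℕ
  /-- number of argument halvings in `MC.expI` -/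
  k : ℕ

namespace MPParams

/-- The scale `S = 2^sb`. [folklore] -/
def S (P : MPParams) : ℕ := 2 ^ P.sb

/-- `0 < S`. [folklore] -/
theorem S_pos (P : MPParams) : 0 < P.S := by unfold S; positivity

end MPParams

/-- Rational enclosures `(cl, ch, sl, sh)` of `cos(u log n)` and `sin(u log n)` (`cl ≤ cos ≤ ch`, `sl ≤ sin ≤ sh`) from the
multi-precision engine; `none` if the engine declines. [folklore] -/
def trigEnclMP (P : MPParams) (n : ℕ) (u : ℚ) : Option (ℚ × ℚ × ℚ × ℚ) :=
  match MI.logNat P.S P.K n, MI.pi P.S P.K with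
  | some L, some piI =>
    match MC.expI P.S P.K P.k piI ((L.mulInt u.num).divNat u.den) with
    | some E => some ((E.re.lo : ℚ) / P.S, (E.re.hi : ℚ) / P.S, (E.im.lo : ℚ) / P.S, (E.im.hi : ℚ) / P.S)
    | none => none
  | _, _ => none

/-- From `MI.mem S x I`: `I.lo/S ≤ x ≤ I.hi/S`. [folklore] -/
theorem MI_mem_bounds {S : ℕ} (hS : 0 < S) {x : ℝ} {I : MI} (h : MI.mem S x I) :
    (((I.lo : ℚ) / S : ℚ) : ℝ) ≤ x ∧ x ≤ (((I.hi : ℚ) / S : ℚ) : ℝ) := by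
  have hSr : (0 : ℝ) < S := by exact_mod_cast hS
  obtain ⟨h1, h2⟩ := h
  constructor
  · push_cast; rw [div_le_iff₀ hSr]; exact h1
  · push_cast; rw [le_div_iff₀ hSr]; exact h2

/-- **Soundness of `trigEnclMP`.** [folklore] -/
theorem trigEnclMP_spec {P : MPParams} {n : ℕ} {u : ℚ} {cl ch sl sh : ℚ}
    (h : trigEnclMP P n u = some (cl, ch, sl, sh)) :
    (cl : ℝ) ≤ Real.cos ((u : ℝ) * Real.log n) ∧ Real.cos ((u : ℝ) * Real.log n) ≤ (ch : ℝ) ∧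
      (sl : ℝ) ≤ Real.sin ((u : ℝ) * Real.log n) ∧ Real.sin ((u : ℝ) * Real.log n) ≤ (sh : ℝ) := by
  unfold trigEnclMP at h
  split at h
  · rename_i L piI hL hpi
    split at h
    · rename_i E hE
      simp only [Option.some.injEq, Prod.mk.injEq] at h
      obtain ⟨rfl, rfl, rfl, rfl⟩ := h
      have hS := P.S_pos
      have hlog := MI.mem_logNat hS hL
      have hpim := MI.mem_pi P.S hpi
      set θr : ℝ := (u : ℝ) * Real.log n with hθr
      have hθ : MI.mem P.S θr ((L.mulInt u.num).divNat u.den) := by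
        have h1 := MI.mem_divNat (MI.mem_mulInt hlog u.num) u.pos
        have e : Real.log n * (u.num : ℤ) / (u.den : ℕ) = θr := by
          rw [hθr, Rat.cast_def u]; ring
        rw [e] at h1
        exact h1
      have hexp := MC.mem_expI hS hpim hE hθ
      have hre : MI.mem P.S (Real.cos θr) E.re := by
        have h1 := hexp.1
        rwa [Complex.exp_ofReal_mul_I_re] at h1
      have him : MI.mem P.S (Real.sin θr) E.im := by
        have h1 := hexp.2
        rwa [Complex.exp_ofReal_mul_I_im] at h1
      obtain ⟨a1, a2⟩ := MI_mem_bounds hS hre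
      obtain ⟨b1, b2⟩ := MI_mem_bounds hS him
      exact ⟨a1, a2, b1, b2⟩
    · simp at h
  · simp at h

/-- The smaller of the four corner products `−C·c`, `C ∈ {Clo, Chi}`, `c ∈ {cl, ch}`. [folklore] -/
def negProdLo (Clo Chi cl ch : ℚ) : ℚ := min (min (-(Clo * cl)) (-(Clo * ch))) (min (-(Chi * cl)) (-(Chi * ch)))

/-- The smaller of the four corner products `C·s`. [folklore] -/
def prodLo (Clo Chi sl sh : ℚ) : ℚ := min (min (Clo * sl) (Clo * sh)) (min (Chi * sl) (Chi * sh))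

/-- A bilinear form on a box is bounded below by its smallest corner value (`−C·c`). [folklore] -/
theorem negProdLo_le {Clo Chi cl ch : ℚ} {C c : ℝ} (hC1 : (Clo : ℝ) ≤ C) (hC2 : C ≤ (Chi : ℝ))
    (hc1 : (cl : ℝ) ≤ c) (hc2 : c ≤ (ch : ℝ)) : ((negProdLo Clo Chi cl ch : ℚ) : ℝ) ≤ -(C * c) := by
  unfold negProdLo
  push_cast
  rcases le_total 0 c with hc | hc
  · -- c ≥ 0: -(C c) ≥ -(Chi c); and -(Chi c) ≥ min(-(Chi cl), -(Chi ch))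
    have h1 : -(C * c) ≥ -((Chi : ℝ) * c) := by nlinarith
    rcases le_total 0 (Chi : ℝ) with hC | hC
    · have h2 : -((Chi : ℝ) * c) ≥ -((Chi : ℝ) * ch) := by nlinarith
      have := min_le_right (min (-((Clo : ℝ) * cl)) (-((Clo : ℝ) * ch))) (min (-((Chi : ℝ) * cl)) (-((Chi : ℝ) * ch)))
      have := min_le_right (-((Chi : ℝ) * cl)) (-((Chi : ℝ) * ch))
      linarith
    · have h2 : -((Chi : ℝ) * c) ≥ -((Chi : ℝ) * cl) := by nlinarith
      have := min_le_right (min (-((Clo : ℝ) * cl)) (-((Clo : ℝ) * ch))) (min (-((Chi : ℝ) * cl)) (-((Chi : ℝ) * ch)))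
      have := min_le_left (-((Chi : ℝ) * cl)) (-((Chi : ℝ) * ch))
      linarith
  · have h1 : -(C * c) ≥ -((Clo : ℝ) * c) := by nlinarith
    rcases le_total 0 (Clo : ℝ) with hC | hC
    · have h2 : -((Clo : ℝ) * c) ≥ -((Clo : ℝ) * ch) := by nlinarith
      have := min_le_left (min (-((Clo : ℝ) * cl)) (-((Clo : ℝ) * ch))) (min (-((Chi : ℝ) * cl)) (-((Chi : ℝ) * ch)))
      have := min_le_right (-((Clo : ℝ) * cl)) (-((Clo : ℝ) * ch))
      linarith
    · have h2 : -((Clo : ℝ) * c) ≥ -((Clo : ℝ) * cl) := by nlinarith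
      have := min_le_left (min (-((Clo : ℝ) * cl)) (-((Clo : ℝ) * ch))) (min (-((Chi : ℝ) * cl)) (-((Chi : ℝ) * ch)))
      have := min_le_left (-((Clo : ℝ) * cl)) (-((Clo : ℝ) * ch))
      linarith

/-- A bilinear form on a box is bounded below by its smallest corner value (`C·s`). [folklore] -/
theorem prodLo_le {Clo Chi sl sh : ℚ} {C s : ℝ} (hC1 : (Clo : ℝ) ≤ C) (hC2 : C ≤ (Chi : ℝ))
    (hs1 : (sl : ℝ) ≤ s) (hs2 : s ≤ (sh : ℝ)) : ((prodLo Clo Chi sl sh : ℚ) : ℝ) ≤ C * s := by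
  have h := negProdLo_le (Clo := Clo) (Chi := Chi) (cl := -sh) (ch := -sl) (C := C) (c := -s) hC1 hC2
    (by push_cast; linarith) (by push_cast; linarith)
  have e : ((negProdLo Clo Chi (-sh) (-sl) : ℚ) : ℝ) = ((prodLo Clo Chi sl sh : ℚ) : ℝ) := by
    unfold negProdLo prodLo
    push_cast
    rw [show -((Clo : ℝ) * -sh) = Clo * sh by ring, show -((Clo : ℝ) * -sl) = Clo * sl by ring,
      show -((Chi : ℝ) * -sh) = Chi * sh by ring, show -((Chi : ℝ) * -sl) = Chi * sl by ring,
      min_comm ((Clo : ℝ) * sh), min_comm ((Chi : ℝ) * sh)]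
  rw [← e]
  simpa using h

/-- Multi-precision lower bounds `(alo', blo')` of `α_n(u) = −C_n cos(u log n)` and `β_n(u) = C_n sin(u log n)` for an
amplitude `C_n ∈ [CI.loQ, CI.hiQ]` (`CI` a fixed-point interval of the small engine: `cZeroFI ∋ √2 log 2`, `cThreeFI ∋ 2 log 3/√3`). [folklore] -/
def rippleLoMP (P : MPParams) (n : ℕ) (CI : FI) (u : ℚ) : Option (ℚ × ℚ) :=
  match trigEnclMP P n u with
  | some (cl, ch, sl, sh) => some (negProdLo CI.loQ CI.hiQ cl ch, prodLo CI.loQ CI.hiQ sl sh)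
  | none => none

/-- **Soundness of `rippleLoMP`.** [folklore] -/
theorem rippleLoMP_spec {P : MPParams} {n : ℕ} {CI : FI} {C : ℝ} (hC : FI.mem C CI) {u : ℚ} {a b : ℚ}
    (h : rippleLoMP P n CI u = some (a, b)) :
    (a : ℝ) ≤ -(C * Real.cos ((u : ℝ) * Real.log n)) ∧ (b : ℝ) ≤ C * Real.sin ((u : ℝ) * Real.log n) := by
  unfold rippleLoMP at h
  split at h
  · rename_i cl ch sl sh ht
    simp only [Option.some.injEq, Prod.mk.injEq] at h
    obtain ⟨rfl, rfl⟩ := h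
    obtain ⟨h1, h2, h3, h4⟩ := trigEnclMP_spec ht
    exact ⟨negProdLo_le (FI.loQ_le hC) (FI.le_hiQ hC) h1 h2, prodLo_le (FI.loQ_le hC) (FI.le_hiQ hC) h3 h4⟩
  · simp at h

/-! ## Ripple soundness from REAL hypotheses on the constants -/

namespace FPDCell

variable {c : FPDCell}

/-- **Ripple soundness from the unpacked side conditions, real form.** As `FPDCell.polyR_cosPart_le_of`, with the two engine
comparisons replaced by the real inequalities they imply. On the cell, `P(t − u) ≤ −√2 log 2 cos(t log 2)`. [folklore] -/
theorem polyR_cosPart_le_real (hn : 0 < c.n) (hL0q : 0 ≤ c.Llo)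
    (hwq : (c.psi.v - c.psi.u) * c.Lhi ≤ 1) (hLloq : c.Llo ≤ logTwoLoQ) (hLhiq : logTwoHiQ ≤ c.Lhi)
    (ha : (c.alo : ℝ) ≤ -(Real.sqrt 2 * Real.log 2 * Real.cos ((c.psi.u : ℝ) * Real.log 2)))
    (hb : (c.blo : ℝ) ≤ Real.sqrt 2 * Real.log 2 * Real.sin ((c.psi.u : ℝ) * Real.log 2))
    {t : ℝ} (hut : (c.psi.u : ℝ) ≤ t) (htv : t ≤ (c.psi.v : ℝ)) :
    polyR c.cosPart (t - c.psi.u) ≤ -(Real.sqrt 2 * Real.log 2 * Real.cos (t * Real.log 2)) := by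
  set L : ℝ := Real.log 2 with hLdef
  set u : ℝ := (c.psi.u : ℝ) with hudef
  set hh : ℝ := t - u with hhdef
  have hL0 : (0 : ℝ) ≤ c.Llo := by exact_mod_cast hL0q
  have hL1 : (c.Llo : ℝ) ≤ L := le_trans (by exact_mod_cast hLloq) logTwo_mem_Q.1
  have hL2 : L ≤ (c.Lhi : ℝ) := le_trans logTwo_mem_Q.2 (by exact_mod_cast hLhiq)
  have hLnn : 0 ≤ L := hL0.trans hL1
  have hh0 : 0 ≤ hh := by rw [hhdef]; linarith
  have hhw : hh ≤ (c.psi.v : ℝ) - c.psi.u := by rw [hhdef, hudef]; linarith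
  have hhL : hh * L ≤ 1 := by
    have h1 : hh * L ≤ ((c.psi.v : ℝ) - c.psi.u) * c.Lhi :=
      mul_le_mul hhw hL2 hLnn (by linarith)
    have h2 : ((c.psi.v : ℝ) - c.psi.u) * c.Lhi ≤ 1 := by exact_mod_cast hwq
    linarith
  have hy0 : 0 ≤ hh * L := mul_nonneg hh0 hLnn
  have hcos0 : 0 ≤ Real.cos (hh * L) :=
    Real.cos_nonneg_of_mem_Icc ⟨by linarith [Real.pi_pos], by linarith [Real.pi_gt_three]⟩
  have hsin0 : 0 ≤ Real.sin (hh * L) :=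
    Real.sin_nonneg_of_nonneg_of_le_pi hy0 (by linarith [Real.pi_gt_three])
  set α : ℝ := -(Real.sqrt 2 * Real.log 2 * Real.cos (u * L)) with hαdef
  set β : ℝ := Real.sqrt 2 * Real.log 2 * Real.sin (u * L) with hβdef
  have hadd : -(Real.sqrt 2 * Real.log 2 * Real.cos (t * Real.log 2)) =
      α * Real.cos (hh * L) + β * Real.sin (hh * L) := by
    have : t * Real.log 2 = u * L + hh * L := by rw [hhdef, hLdef]; ring
    rw [this, Real.cos_add, hαdef, hβdef]
    ring
  rw [hadd, polyR_cosPart]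
  refine add_le_add ?_ ?_
  · unfold cosBracket
    split_ifs with hsgn
    · have h0 : (0 : ℝ) ≤ c.alo := by exact_mod_cast hsgn
      calc (c.alo : ℝ) * polyR (cosLoCoeffs c.Llo c.Lhi c.n) hh
          ≤ (c.alo : ℝ) * Real.cos (hh * L) :=
            mul_le_mul_of_nonneg_left (polyR_cosLo_le hL0 hL1 hL2 hh0 hhL hn) h0
        _ ≤ α * Real.cos (hh * L) := mul_le_mul_of_nonneg_right ha hcos0
    · push Not at hsgn
      have h0 : (c.alo : ℝ) ≤ 0 := by exact_mod_cast hsgn.le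
      calc (c.alo : ℝ) * polyR (cosUpCoeffs c.Llo c.Lhi c.n) hh
          ≤ (c.alo : ℝ) * Real.cos (hh * L) :=
            mul_le_mul_of_nonpos_left (cos_le_polyR_cosUp hL0 hL1 hL2 hh0 hhL hn) h0
        _ ≤ α * Real.cos (hh * L) := mul_le_mul_of_nonneg_right ha hcos0
  · unfold sinBracket
    split_ifs with hsgn
    · have h0 : (0 : ℝ) ≤ c.blo := by exact_mod_cast hsgn
      calc (c.blo : ℝ) * polyR (sinLoCoeffs c.Llo c.Lhi c.n) hh
          ≤ (c.blo : ℝ) * Real.sin (hh * L) :=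
            mul_le_mul_of_nonneg_left (polyR_sinLo_le hL0 hL1 hL2 hh0 hhL hn) h0
        _ ≤ β * Real.sin (hh * L) := mul_le_mul_of_nonneg_right hb hsin0
    · push Not at hsgn
      have h0 : (c.blo : ℝ) ≤ 0 := by exact_mod_cast hsgn.le
      calc (c.blo : ℝ) * polyR (sinUpCoeffs c.Llo c.Lhi c.n) hh
          ≤ (c.blo : ℝ) * Real.sin (hh * L) :=
            mul_le_mul_of_nonpos_left (sin_le_polyR_sinUp hL0 hL1 hL2 hh0 hhL hn) h0
        _ ≤ β * Real.sin (hh * L) := mul_le_mul_of_nonneg_right hb hsin0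

/-- **Multi-precision check of a first-prime cell**: the digamma part by `WeilCell.checkZ`, then `n ≥ 1`, `0 ≤ Llo`,
`(v − u) · Lhi ≤ 1`, the `log 2` bracket against the engine table, and the ripple constants `alo`, `blo` against the
MULTI-PRECISION bounds `rippleLoMP P 2 cZeroFI u`. [folklore] -/
def checkZMP (p j : ℕ) (P : MPParams) (c : FPDCell) : Bool :=
  c.psi.checkZ p j && decide (0 < c.n) && decide (0 ≤ c.Llo) &&
    decide ((c.psi.v - c.psi.u) * c.Lhi ≤ 1) &&
    decide (c.Llo ≤ logTwoLoQ) && decide (logTwoHiQ ≤ c.Lhi) &&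
    (match rippleLoMP P 2 cZeroFI c.psi.u with
      | some (a, b) => decide (c.alo ≤ a) && decide (c.blo ≤ b)
      | none => false)

/-- Unpacking `checkZMP`: the side conditions and the REAL ripple inequalities. [folklore] -/
theorem checkZMP_spec {p j : ℕ} {P : MPParams} (h : c.checkZMP p j P = true) :
    c.psi.checkZ p j = true ∧ 0 < c.n ∧ 0 ≤ c.Llo ∧ (c.psi.v - c.psi.u) * c.Lhi ≤ 1 ∧
      c.Llo ≤ logTwoLoQ ∧ logTwoHiQ ≤ c.Lhi ∧
      (c.alo : ℝ) ≤ -(Real.sqrt 2 * Real.log 2 * Real.cos ((c.psi.u : ℝ) * Real.log 2)) ∧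
      (c.blo : ℝ) ≤ Real.sqrt 2 * Real.log 2 * Real.sin ((c.psi.u : ℝ) * Real.log 2) := by
  unfold checkZMP at h
  split at h
  · rename_i a b hab
    simp only [Bool.and_eq_true, decide_eq_true_eq] at h
    obtain ⟨⟨⟨⟨⟨⟨hpsi, hn⟩, hL0⟩, hw⟩, hLlo⟩, hLhi⟩, ha, hb⟩ := h
    have hs := rippleLoMP_spec mem_cZeroFI hab
    have e2 : Real.log ((2 : ℕ) : ℝ) = Real.log 2 := by norm_num
    rw [e2] at hs
    exact ⟨hpsi, hn, hL0, hw, hLlo, hLhi, le_trans (by exact_mod_cast ha) hs.1, le_trans (by exact_mod_cast hb) hs.2⟩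
  · simp at h

/-- **Cell soundness (multi-precision checker).** On its cell, `σ(t) ≤ Re ψ(1/4 + it/2) − √2 log 2 cos(t log 2)`. [folklore] -/
theorem sigma_le_MP {p j : ℕ} {P : MPParams} (h : c.checkZMP p j P = true) {t : ℝ} (hut : (c.psi.u : ℝ) ≤ t)
    (htv : t ≤ (c.psi.v : ℝ)) :
    c.sigma t ≤ reDigammaQuarter t - Real.sqrt 2 * Real.log 2 * Real.cos (t * Real.log 2) := by
  obtain ⟨hpsi, hn, hL0q, hwq, hLloq, hLhiq, ha, hb⟩ := checkZMP_spec h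
  have h1 := WeilCell.sigma_le_Z hpsi hut htv
  have h2 := polyR_cosPart_le_real hn hL0q hwq hLloq hLhiq ha hb hut htv
  unfold sigma
  linarith

end FPDCell

namespace TPDCell

variable {c : TPDCell}

/-- **Second-ripple soundness, real form.** As `TPDCell.polyR_cosPart3_le_of`, with the two engine comparisons replaced by the
real inequalities they imply. On the cell, `P₃(t − u) ≤ −(2 log 3/√3) cos(t log 3)`. [folklore] -/
theorem polyR_cosPart3_le_real (hn : 0 < c.n3) (hL0q : 0 ≤ c.L3lo)
    (hwq : (c.fp.psi.v - c.fp.psi.u) * c.L3hi ≤ 1) (hLloq : c.L3lo ≤ logThreeLoQ')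
    (hLhiq : logThreeHiQ' ≤ c.L3hi)
    (ha : (c.a3lo : ℝ) ≤ -(2 * Real.log 3 / Real.sqrt 3 * Real.cos ((c.fp.psi.u : ℝ) * Real.log 3)))
    (hb : (c.b3lo : ℝ) ≤ 2 * Real.log 3 / Real.sqrt 3 * Real.sin ((c.fp.psi.u : ℝ) * Real.log 3))
    {t : ℝ} (hut : (c.fp.psi.u : ℝ) ≤ t) (htv : t ≤ (c.fp.psi.v : ℝ)) :
    polyR c.cosPart3 (t - c.fp.psi.u) ≤
      -(2 * Real.log 3 / Real.sqrt 3 * Real.cos (t * Real.log 3)) := by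
  set L : ℝ := Real.log 3 with hLdef
  set u : ℝ := (c.fp.psi.u : ℝ) with hudef
  set hh : ℝ := t - u with hhdef
  have hL0 : (0 : ℝ) ≤ c.L3lo := by exact_mod_cast hL0q
  have hL1 : (c.L3lo : ℝ) ≤ L := le_trans (by exact_mod_cast hLloq) logThree_mem_Q.1
  have hL2 : L ≤ (c.L3hi : ℝ) := le_trans logThree_mem_Q.2 (by exact_mod_cast hLhiq)
  have hLnn : 0 ≤ L := hL0.trans hL1
  have hh0 : 0 ≤ hh := by rw [hhdef]; linarith
  have hhw : hh ≤ (c.fp.psi.v : ℝ) - c.fp.psi.u := by rw [hhdef, hudef]; linarith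
  have hhL : hh * L ≤ 1 := by
    have h1 : hh * L ≤ ((c.fp.psi.v : ℝ) - c.fp.psi.u) * c.L3hi :=
      mul_le_mul hhw hL2 hLnn (by linarith)
    have h2 : ((c.fp.psi.v : ℝ) - c.fp.psi.u) * c.L3hi ≤ 1 := by exact_mod_cast hwq
    linarith
  have hy0 : 0 ≤ hh * L := mul_nonneg hh0 hLnn
  have hcos0 : 0 ≤ Real.cos (hh * L) :=
    Real.cos_nonneg_of_mem_Icc ⟨by linarith [Real.pi_pos], by linarith [Real.pi_gt_three]⟩
  have hsin0 : 0 ≤ Real.sin (hh * L) :=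
    Real.sin_nonneg_of_nonneg_of_le_pi hy0 (by linarith [Real.pi_gt_three])
  set α : ℝ := -(2 * Real.log 3 / Real.sqrt 3 * Real.cos (u * L)) with hαdef
  set β : ℝ := 2 * Real.log 3 / Real.sqrt 3 * Real.sin (u * L) with hβdef
  have hadd : -(2 * Real.log 3 / Real.sqrt 3 * Real.cos (t * Real.log 3)) =
      α * Real.cos (hh * L) + β * Real.sin (hh * L) := by
    have : t * Real.log 3 = u * L + hh * L := by rw [hhdef, hLdef]; ring
    rw [this, Real.cos_add, hαdef, hβdef]
    ring
  rw [hadd, polyR_cosPart3]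
  refine add_le_add ?_ ?_
  · unfold cosBracket3
    split_ifs with hsgn
    · have h0 : (0 : ℝ) ≤ c.a3lo := by exact_mod_cast hsgn
      calc (c.a3lo : ℝ) * polyR (cosLoCoeffs c.L3lo c.L3hi c.n3) hh
          ≤ (c.a3lo : ℝ) * Real.cos (hh * L) :=
            mul_le_mul_of_nonneg_left (polyR_cosLo_le hL0 hL1 hL2 hh0 hhL hn) h0
        _ ≤ α * Real.cos (hh * L) := mul_le_mul_of_nonneg_right ha hcos0
    · push Not at hsgn
      have h0 : (c.a3lo : ℝ) ≤ 0 := by exact_mod_cast hsgn.le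
      calc (c.a3lo : ℝ) * polyR (cosUpCoeffs c.L3lo c.L3hi c.n3) hh
          ≤ (c.a3lo : ℝ) * Real.cos (hh * L) :=
            mul_le_mul_of_nonpos_left (cos_le_polyR_cosUp hL0 hL1 hL2 hh0 hhL hn) h0
        _ ≤ α * Real.cos (hh * L) := mul_le_mul_of_nonneg_right ha hcos0
  · unfold sinBracket3
    split_ifs with hsgn
    · have h0 : (0 : ℝ) ≤ c.b3lo := by exact_mod_cast hsgn
      calc (c.b3lo : ℝ) * polyR (sinLoCoeffs c.L3lo c.L3hi c.n3) hh
          ≤ (c.b3lo : ℝ) * Real.sin (hh * L) :=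
            mul_le_mul_of_nonneg_left (polyR_sinLo_le hL0 hL1 hL2 hh0 hhL hn) h0
        _ ≤ β * Real.sin (hh * L) := mul_le_mul_of_nonneg_right hb hsin0
    · push Not at hsgn
      have h0 : (c.b3lo : ℝ) ≤ 0 := by exact_mod_cast hsgn.le
      calc (c.b3lo : ℝ) * polyR (sinUpCoeffs c.L3lo c.L3hi c.n3) hh
          ≤ (c.b3lo : ℝ) * Real.sin (hh * L) :=
            mul_le_mul_of_nonpos_left (sin_le_polyR_sinUp hL0 hL1 hL2 hh0 hhL hn) h0
        _ ≤ β * Real.sin (hh * L) := mul_le_mul_of_nonneg_right hb hsin0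

/-- **Multi-precision check of a two-prime cell**: the first-prime part by `FPDCell.checkZMP`, then `n3 ≥ 1`, `0 ≤ L3lo`,
`(v − u) · L3hi ≤ 1`, the `log 3` bracket against the engine table, and `a3lo`, `b3lo` against `rippleLoMP P 3 cThreeFI u`.
(No level test: the certificate works with a SIGNED `γ = wL − σ`.) [folklore] -/
def checkZMP (p j : ℕ) (P : MPParams) (c : TPDCell) : Bool :=
  c.fp.checkZMP p j P && decide (0 < c.n3) && decide (0 ≤ c.L3lo) &&
    decide ((c.fp.psi.v - c.fp.psi.u) * c.L3hi ≤ 1) &&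
    decide (c.L3lo ≤ logThreeLoQ') && decide (logThreeHiQ' ≤ c.L3hi) &&
    (match rippleLoMP P 3 cThreeFI c.fp.psi.u with
      | some (a, b) => decide (c.a3lo ≤ a) && decide (c.b3lo ≤ b)
      | none => false)

/-- Unpacking `checkZMP`. [folklore] -/
theorem checkZMP_spec {p j : ℕ} {P : MPParams} (h : c.checkZMP p j P = true) :
    c.fp.checkZMP p j P = true ∧ 0 < c.n3 ∧ 0 ≤ c.L3lo ∧ (c.fp.psi.v - c.fp.psi.u) * c.L3hi ≤ 1 ∧
      c.L3lo ≤ logThreeLoQ' ∧ logThreeHiQ' ≤ c.L3hi ∧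
      (c.a3lo : ℝ) ≤ -(2 * Real.log 3 / Real.sqrt 3 * Real.cos ((c.fp.psi.u : ℝ) * Real.log 3)) ∧
      (c.b3lo : ℝ) ≤ 2 * Real.log 3 / Real.sqrt 3 * Real.sin ((c.fp.psi.u : ℝ) * Real.log 3) := by
  unfold checkZMP at h
  split at h
  · rename_i a b hab
    simp only [Bool.and_eq_true, decide_eq_true_eq] at h
    obtain ⟨⟨⟨⟨⟨⟨hfp, hn⟩, hL0⟩, hw⟩, hLlo⟩, hLhi⟩, ha, hb⟩ := h
    have hs := rippleLoMP_spec mem_cThreeFI hab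
    have e3 : Real.log ((3 : ℕ) : ℝ) = Real.log 3 := by norm_num
    rw [e3] at hs
    exact ⟨hfp, hn, hL0, hw, hLlo, hLhi, le_trans (by exact_mod_cast ha) hs.1, le_trans (by exact_mod_cast hb) hs.2⟩
  · simp at h

/-- **Cell soundness (multi-precision checker).** On its cell, `σ(t) ≤ w₂₃(t)`. [folklore] -/
theorem sigma_le_MP {p j : ℕ} {P : MPParams} (h : c.checkZMP p j P = true) {t : ℝ}
    (hut : (c.fp.psi.u : ℝ) ≤ t) (htv : t ≤ (c.fp.psi.v : ℝ)) : c.sigma t ≤ weilTwoPrimeWeight t := by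
  obtain ⟨hfp, hn, hL0q, hwq, hLloq, hLhiq, ha, hb⟩ := checkZMP_spec h
  have h1 := FPDCell.sigma_le_MP hfp hut htv
  have h2 := polyR_cosPart3_le_real hn hL0q hwq hLloq hLhiq ha hb hut htv
  unfold sigma weilTwoPrimeWeight
  linarith

/-- A cell passing `checkZMP` has `0 ≤ u`. [folklore] -/
theorem u_nonneg_MP {p j : ℕ} {P : MPParams} (h : c.checkZMP p j P = true) : 0 ≤ c.fp.psi.u :=
  WeilCell.u_nonneg_Z ((FPDCell.checkZMP_spec (checkZMP_spec h).1).1)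

/-- A cell passing `checkZMP` has `u < v`. [folklore] -/
theorem u_lt_v_MP {p j : ℕ} {P : MPParams} (h : c.checkZMP p j P = true) : c.fp.psi.u < c.fp.psi.v :=
  WeilCell.u_lt_v_Z ((FPDCell.checkZMP_spec (checkZMP_spec h).1).1)

/-- **A cell passing the multi-precision check is valid.** [folklore] -/
theorem valid_of_checkZMP {p j : ℕ} {P : MPParams} (h : c.checkZMP p j P = true) : c.Valid :=
  ⟨u_nonneg_MP h, u_lt_v_MP h, fun _t hut htv ↦ sigma_le_MP h hut htv,
    fun wL _t hut htv ↦ abs_level_sub_sigma_le_of (u_nonneg_MP h) wL hut htv,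
    fun wL ↦ bndQ_nonneg_of (u_nonneg_MP h) (u_lt_v_MP h) wL⟩

end TPDCell

/-! ## The chain checker -/

/-- **Multi-precision integer checker of a two-prime chain**: chain from `0` to `T`, every cell `checkZMP`, `j ≥ 1`,
`T` dyadic, and the level test `wL + c₀⁺ + c₃⁺ ≤ wLoZ` at `T`. [folklore] -/
def checkCells₂₃MP (p j : ℕ) (P : MPParams) (wL T : ℚ) (mwT : ℕ) (cells : List TPDCell) : Bool :=
  checkChain₂₃ cells 0 T && cells.all (fun c ↦ c.checkZMP p j P) && decide (1 ≤ j) &&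
    decide (T * 2 ^ j = ((dyNum T j : ℕ) : ℚ)) &&
    decide (wL + cZeroFI.hiQ + cThreeFI.hiQ ≤ wLoZ p (dyNum T j) j mwT)

/-- **A chain passing the multi-precision checker is valid** (`CellsOK₂₃`, the hypothesis of
`WeilCert23.margin_step3_of_cellsOK` / `WeilCert23.weilTwoPrimeQuadratic_margin_of_cellsOK`). [folklore] -/
theorem cellsOK_of_checkCells₂₃MP {p j : ℕ} {P : MPParams} {wL T : ℚ} {mwT : ℕ} {cells : List TPDCell}
    (h : checkCells₂₃MP p j P wL T mwT cells = true) : CellsOK₂₃ wL T cells := by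
  simp only [checkCells₂₃MP, Bool.and_eq_true, List.all_eq_true, decide_eq_true_eq] at h
  obtain ⟨⟨⟨⟨hchain, hall⟩, hj⟩, hT⟩, hwL⟩ := h
  have hvalid : ∀ c ∈ cells, c.Valid := fun c hc ↦ TPDCell.valid_of_checkZMP (hall c hc)
  have hT0 : 0 ≤ T := (chain_bounds₂₃ hchain hvalid).1
  refine ⟨hchain, hvalid, fun t ht ↦ level_of_le₂₃ hT0 ?_ ht⟩
  have hc0 : Real.sqrt 2 * Real.log 2 ≤ (cZeroFI.hiQ : ℝ) := FI.le_hiQ mem_cZeroFI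
  have hc3 : 2 * Real.log 3 / Real.sqrt 3 ≤ (cThreeFI.hiQ : ℝ) := FI.le_hiQ mem_cThreeFI
  have hwL' : ((wL : ℚ) : ℝ) + cZeroFI.hiQ + cThreeFI.hiQ ≤ wLoZ p (dyNum T j) j mwT := by
    exact_mod_cast hwL
  have hTe : ((dyNum T j : ℕ) : ℝ) / 2 ^ j = (T : ℝ) := by
    have : (T : ℝ) * 2 ^ j = ((dyNum T j : ℕ) : ℝ) := by exact_mod_cast hT
    rw [← this, mul_div_assoc, div_self (by positivity), mul_one]
  have hlev := wLoZ_le p (dyNum T j) hj mwT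
  rw [hTe] at hlev
  linarith

/-- **A chain passing the multi-precision checker, split in chunks**: if the chain test, the dyadic/level tests and the
per-chunk cell checks hold for `cells = C.join`-style concatenations, `CellsOK₂₃` follows; convenience form taking the cell
checks as a hypothesis on `List.all`. [folklore] -/
theorem cellsOK_of_parts₂₃MP {p j : ℕ} {P : MPParams} {wL T : ℚ} {mwT : ℕ} {cells : List TPDCell}
    (hchain : checkChain₂₃ cells 0 T = true) (hall : (cells.all fun c ↦ c.checkZMP p j P) = true) (hj : 1 ≤ j)
    (hT : T * 2 ^ j = ((dyNum T j : ℕ) : ℚ)) (hwL : wL + cZeroFI.hiQ + cThreeFI.hiQ ≤ wLoZ p (dyNum T j) j mwT) :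
    CellsOK₂₃ wL T cells := by
  apply cellsOK_of_checkCells₂₃MP (p := p) (j := j) (P := P) (mwT := mwT)
  unfold checkCells₂₃MP
  simp [hchain, hall, hj, hT, hwL]

end Literature.NumberTheory.LFunctions
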